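import Summits.BirchSwinnertonDyer.BirchSwinnertonDyer.Theorems.ResidualThetaTransportAtTwoSignedMuSeedAtTwoPlusJetLevelWall
import HarnessLib

/-!
# The LEVEL-TWO WALL of the seed line `jet-character-sums` (and level one recovered) — instances of the safe-zone closed form
# (crux `SignedMuSeedAtTwoPlus` stmt-BirchSwinnertonDyer-21438; Kμ⁺ stmt-BirchSwinnertonDyer-20689; route `ResidualThetaTransportAtTwo`)

Cell `bsd-wall`, width seat `bsd-wall-rtt-p4-w2` g13 (`--supports`, closes nothing).  THEOREMS ONLY; nothing about any curve, unit or
`μ`-invariant is asserted; the line is NOT registered (W-79); BSD is not proved by this.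

From `…JetLevelWall.coeff_levelStep_safeZone_even` (`[t^e](S + S(t+δ)) = ū·U_{(e−N)/2}² + ū²·C(e−2N+2,2)·U_{e−2N+2}` in the safe zone):
* `natCast_eq_one_of_odd` — odd binomial coefficients are `1` in characteristic `2`;
* **`levelTwo_wall`** — the step `S₁ ↦ S₂` (`N = 16`) after a DEGENERATE level `1` (`ord S₁ ≥ 14`, i.e. `ū₀T₄² + ū₀²T₆ = 0` in
  `…JetLevelOneWall.levelOne_dichotomy`): with `δ₁ = ū₁t¹⁶ + t³²ε` and `Uₙ = [tⁿ]S₁`,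
  `[t⁴⁴]S₂ = ū₁U₁₄² + ū₁²U₁₄`, `[t⁴⁸]S₂ = ū₁U₁₆² + ū₁²U₁₈`, `[t⁵²]S₂ = ū₁U₁₈² + ū₁²U₂₂`, `[t⁵⁶]S₂ = ū₁U₂₀² + ū₁²U₂₆` — the card's J5
  «deep wall» scenario («closed forms stop at level 1») does NOT stop the closed forms: `NonDeg(2)` (`v(S₂) < 62`) is read off
  `U₁₄, U₁₆, U₁₈, U₂₀, U₂₂, U₂₆` of `S₁` up to the last three coefficients `t⁵⁹, t⁶⁰, t⁶¹` below the threshold;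
* `levelOne_wall_again` — `N = 4`, `ord S ≥ 4`: `[t¹²] = ūT₄² + ū²T₆` (`C(6,2) = 15`), agreeing with p678286 `coeff_twelve_levelOne`.

References: the card (J4, J5); [SilvermanAEC2009] IV.1 for context only.
-/

set_option autoImplicit false
-- the Theorems namespace of this sub repeats the summit name by design (D-0017 nested layout)
set_option linter.dupNamespace false

noncomputable section

open PowerSeries Finset

namespace Summit.BirchSwinnertonDyer.BirchSwinnertonDyer.Theorems.SignedMuAtTwo.JetCharacterSums

variable {k : Type*} [CommRing k] [CharP k 2] {S δ ε : PowerSeries k} {u : k}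

/-- A binomial coefficient that is odd is `1` in characteristic `2`. [folklore] -/
theorem natCast_eq_one_of_odd {n : ℕ} (hn : Odd n) : ((n : ℕ) : k) = 1 := by
  obtain ⟨m, rfl⟩ := hn
  have h2k : (2 : k) = 0 := CharTwo.two_eq_zero
  push_cast
  linear_combination (m : k) * h2k

/-- **The LEVEL-TWO WALL** (the step `S₁ ↦ S₂ = S₁ + S₁(t ⊕ y₁)`, `N = 16`, after a degenerate level `1`: `ord S₁ ≥ 14`):
with `δ₁ = ū₁t¹⁶ + t³²ε` and `Uₙ = [tⁿ]S₁`,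
`[t⁴⁴]S₂ = ū₁U₁₄² + ū₁²U₁₄`, `[t⁴⁸]S₂ = ū₁U₁₆² + ū₁²U₁₈`, `[t⁵²]S₂ = ū₁U₁₈² + ū₁²U₂₂`, `[t⁵⁶]S₂ = ū₁U₂₀² + ū₁²U₂₆`
(`C(14,2), C(18,2), C(22,2), C(26,2)` are odd).  `NonDeg(2)` asks `v(S₂) < 62`; the four displayed coefficients and `[t⁶⁰]` (outside the
safe zone by `3`) decide it. [folklore] -/
theorem levelTwo_wall (hR : d⁄dX k S = S * S) (hv : ((14 : ℕ) : ℕ∞) ≤ S.order) (hδ : δ = C u * X ^ 16 + X ^ (2 * 16) * ε) :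
    coeff 44 (S + S.subst (X + δ)) = u * coeff 14 S ^ 2 + u ^ 2 * coeff 14 S ∧
      coeff 48 (S + S.subst (X + δ)) = u * coeff 16 S ^ 2 + u ^ 2 * coeff 18 S ∧
      coeff 52 (S + S.subst (X + δ)) = u * coeff 18 S ^ 2 + u ^ 2 * coeff 22 S ∧
      coeff 56 (S + S.subst (X + δ)) = u * coeff 20 S ^ 2 + u ^ 2 * coeff 26 S := by
  have hN : 1 ≤ 16 := by norm_num
  refine ⟨?_, ?_, ?_, ?_⟩
  · rw [coeff_levelStep_safeZone_even hN hR hv hδ (by norm_num) (by norm_num) (by norm_num) ⟨14, by norm_num⟩,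
      show (44 - 16) / 2 = 14 from rfl, show 44 - 2 * 16 + 2 = 14 from rfl,
      natCast_eq_one_of_odd ⟨45, by norm_num [Nat.choose_two_right]⟩, one_mul]
  · rw [coeff_levelStep_safeZone_even hN hR hv hδ (by norm_num) (by norm_num) (by norm_num) ⟨16, by norm_num⟩,
      show (48 - 16) / 2 = 16 from rfl, show 48 - 2 * 16 + 2 = 18 from rfl,
      natCast_eq_one_of_odd ⟨76, by norm_num [Nat.choose_two_right]⟩, one_mul]
  · rw [coeff_levelStep_safeZone_even hN hR hv hδ (by norm_num) (by norm_num) (by norm_num) ⟨18, by norm_num⟩,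
      show (52 - 16) / 2 = 18 from rfl, show 52 - 2 * 16 + 2 = 22 from rfl,
      natCast_eq_one_of_odd ⟨115, by norm_num [Nat.choose_two_right]⟩, one_mul]
  · rw [coeff_levelStep_safeZone_even hN hR hv hδ (by norm_num) (by norm_num) (by norm_num) ⟨20, by norm_num⟩,
      show (56 - 16) / 2 = 20 from rfl, show 56 - 2 * 16 + 2 = 26 from rfl,
      natCast_eq_one_of_odd ⟨162, by norm_num [Nat.choose_two_right]⟩, one_mul]

/-- **Level one recovered**: `N = 4`, `ord S ≥ 4`: `[t¹²](S + S(t+δ)) = ūT₄² + ū²T₆` (`C(6,2) = 15` odd) — agrees with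
`…JetLevelOneWall.coeff_twelve_levelOne`. [folklore] -/
theorem levelOne_wall_again (hR : d⁄dX k S = S * S) (hv : ((4 : ℕ) : ℕ∞) ≤ S.order) (hδ : δ = C u * X ^ 4 + X ^ (2 * 4) * ε) :
    coeff 12 (S + S.subst (X + δ)) = u * coeff 4 S ^ 2 + u ^ 2 * coeff 6 S := by
  rw [coeff_levelStep_safeZone_even (by norm_num) hR hv hδ (by norm_num) (by norm_num) (by norm_num) ⟨4, by norm_num⟩,
    show (12 - 4) / 2 = 4 from rfl, show 12 - 2 * 4 + 2 = 6 from rfl,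
    natCast_eq_one_of_odd ⟨7, by norm_num [Nat.choose_two_right]⟩, one_mul]


/-- **Level two, odd coefficients vanish**: for odd `e` with `33 ≤ e ≤ 57`, `[t^e]S₂ = 0` (the term `ū₁²·C(e−30,2)·U_{e−30}` has
`U_{e−30} = U_{(e−31)/2}² = 0` by `coeff_odd_of_riccati` and `ord S₁ ≥ 14`). [folklore] -/
theorem levelTwo_wall_odd (hR : d⁄dX k S = S * S) (hv : ((14 : ℕ) : ℕ∞) ≤ S.order) (hδ : δ = C u * X ^ 16 + X ^ (2 * 16) * ε)
    {e : ℕ} (he : Odd e) (h33 : 33 ≤ e) (h57 : e ≤ 57) : coeff e (S + S.subst (X + δ)) = 0 := by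
  obtain ⟨r, rfl⟩ := he
  rw [coeff_levelStep_safeZone_odd (by norm_num) hR hv hδ (by omega) (by omega) (by omega)
    (by rw [Nat.even_sub (by omega)]; simp [Nat.even_add_one]),
    show 2 * r + 1 - 2 * 16 + 2 = 2 * (r - 15) + 1 by omega, coeff_odd_of_riccati hR,
    coeff_of_lt_order (r - 15) (lt_of_lt_of_le (by exact_mod_cast (by omega)) hv)]
  ring

end Summit.BirchSwinnertonDyer.BirchSwinnertonDyer.Theorems.SignedMuAtTwo.JetCharacterSums

end
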